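import Summits.PneNP.PneNP.Theses.OverlapGapAlgebra

/-!
# Sketch for crux idea `local-shadow-value-gap` (crux stmt-PneNP-2463, `SolvableImpliesStableSection`)

SORRY-FREE (rc 0, axioms propext / Classical.choice / Quot.sound). Contents:

* `PathGood`      — the path event of the crux / of `NoStableSection`, verbatim, as a named predicate
  (`pathGood_iff` : it is the conjunction over splice points `splice k Ψ r q`).
* `pathEvent_of_goodSet` — THE BRIDGE, PROVED (pure counting): a map `g` that is `ν`-valid and one-slot
  `ηn`-Lipschitz on a set `G` of instances with `2k(mk+1)·|Gᶜ| ≤ #instances` realises the path event on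
  at least half of all paths. Ingredients: the layer-swapping involution `swapLayers` showing that every
  splice point has the law of a coordinate (`card_filter_splice_not_mem`), the coordinate count
  `card_filter_coord_not_mem` (via `Fin.insertNthEquiv`), the union bound over the `k(mk+1)` splice
  points, and `oneSlotApart_splice_succ` (consecutive splice points differ in at most one literal slot).
* `TypicallyStableValid` — the single-instance, path-free transfer target `C⁺(k,α,η,ν)`.
* `LocalShadowTransfer` — the transferred crux `C⁺`: poly-time solvable with non-vanishing probability
  ⇒ typically-stable valid maps exist for every `η, ν > 0` (conjecture-strength inside the OGP window,
  a theorem-candidate wherever backtrack-free myopic / local-memory algorithms succeed).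
* `transfer_suffices` — PROVED: `LocalShadowTransfer → SolvableImpliesStableSection` (the crux, by name).
-/

set_option linter.dupNamespace false

noncomputable section

namespace Summit.PneNP.PneNP.Cruxes.SolvableImpliesStableSection.LocalShadow

open Finset
open scoped Classical

/-- The path event of the crux (and of `NoStableSection`), verbatim: along the Bresler–Huang splice
path built from `Ψ : Fin (k+1) → instances`, the map `g` violates at most `ν m` clauses at every splice
point and moves at most `η n` in Hamming distance between consecutive splice points. -/
def PathGood (k n m : ℕ) (η ν : ℝ) (g : (Fin m → Fin k → Fin n × Bool) → (Fin n → Bool))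
    (Ψ : Fin (k + 1) → Fin m → Fin k → Fin n × Bool) : Prop :=
  let P : Fin k → ℕ → Fin m → Fin k → Fin n × Bool :=
    fun r q a b => if (a : ℕ) * k + b < q then Ψ r.succ a b else Ψ r.castSucc a b
  (∀ r : Fin k, ∀ q ≤ m * k,
      ((univ.filter fun i : Fin m => ∀ j, g (P r q) (P r q i j).1 ≠ (P r q i j).2).card : ℝ) ≤ ν * m) ∧
    ∀ r : Fin k, ∀ q < m * k, (hammingDist (g (P r q)) (g (P r (q + 1))) : ℝ) ≤ η * n

/-- Number of clauses of `Φ` violated by the assignment `g Φ`. -/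
def violated {k n m : ℕ} (g : (Fin m → Fin k → Fin n × Bool) → (Fin n → Bool))
    (Φ : Fin m → Fin k → Fin n × Bool) : ℕ :=
  (univ.filter fun i : Fin m => ∀ j, g Φ (Φ i j).1 ≠ (Φ i j).2).card

/-- `Φ` and `Φ'` differ in at most one literal slot. -/
def OneSlotApart {k n m : ℕ} (Φ Φ' : Fin m → Fin k → Fin n × Bool) : Prop :=
  (univ.filter fun p : Fin m × Fin k => Φ p.1 p.2 ≠ Φ' p.1 p.2).card ≤ 1

/-! ### The counting bridge: helper lemmas -/

section Bridge

variable {k n m : ℕ}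

/-- The splice point `P r q` of the Bresler–Huang path built from `Ψ`. -/
def splice (k : ℕ) {n m : ℕ} (Ψ : Fin (k + 1) → Fin m → Fin k → Fin n × Bool) (r : Fin k) (q : ℕ) :
    Fin m → Fin k → Fin n × Bool :=
  fun a b => if (a : ℕ) * k + b < q then Ψ r.succ a b else Ψ r.castSucc a b

theorem pathGood_iff {η ν : ℝ} (g : (Fin m → Fin k → Fin n × Bool) → (Fin n → Bool))
    (Ψ : Fin (k + 1) → Fin m → Fin k → Fin n × Bool) :
    PathGood k n m η ν g Ψ ↔
      (∀ r : Fin k, ∀ q ≤ m * k, (violated g (splice k Ψ r q) : ℝ) ≤ ν * m) ∧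
        ∀ r : Fin k, ∀ q < m * k,
          (hammingDist (g (splice k Ψ r q)) (g (splice k Ψ r (q + 1))) : ℝ) ≤ η * n :=
  Iff.rfl

/-- Swap the slots of index `< q` between the layers `r.castSucc` and `r.succ`. -/
def swapLayers (k : ℕ) {n m : ℕ} (r : Fin k) (q : ℕ)
    (Ψ : Fin (k + 1) → Fin m → Fin k → Fin n × Bool) : Fin (k + 1) → Fin m → Fin k → Fin n × Bool :=
  fun i a b =>
    if (a : ℕ) * k + b < q then
      (if i = r.castSucc then Ψ r.succ a b else if i = r.succ then Ψ r.castSucc a b else Ψ i a b)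
    else Ψ i a b

theorem swapLayers_castSucc (r : Fin k) (q : ℕ) (Ψ : Fin (k + 1) → Fin m → Fin k → Fin n × Bool) :
    swapLayers k r q Ψ r.castSucc = splice k Ψ r q := by
  funext a b
  unfold swapLayers splice
  by_cases h : (a : ℕ) * k + b < q
  · simp [h]
  · simp [h]

theorem swapLayers_swapLayers (r : Fin k) (q : ℕ)
    (Ψ : Fin (k + 1) → Fin m → Fin k → Fin n × Bool) :
    swapLayers k r q (swapLayers k r q Ψ) = Ψ := by
  have hne : r.castSucc ≠ r.succ := (Fin.castSucc_lt_succ (i := r)).ne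
  funext i a b
  unfold swapLayers
  by_cases h : (a : ℕ) * k + b < q
  · by_cases hi : i = r.castSucc
    · subst hi
      simp [h, hne.symm]
    · by_cases hi' : i = r.succ
      · subst hi'
        simp [h, hne.symm]
      · simp [h, hi, hi']
  · simp [h]

theorem swapLayers_injective (r : Fin k) (q : ℕ) :
    Function.Injective (swapLayers k (n := n) (m := m) r q) :=
  Function.LeftInverse.injective (swapLayers_swapLayers r q)

/-- The law of a splice point is the law of a coordinate: counting version. -/
theorem card_filter_splice_not_mem (G : Finset (Fin m → Fin k → Fin n × Bool)) (r : Fin k) (q : ℕ) :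
    (univ.filter fun Ψ : Fin (k + 1) → Fin m → Fin k → Fin n × Bool => splice k Ψ r q ∉ G).card =
      (univ.filter fun Ψ : Fin (k + 1) → Fin m → Fin k → Fin n × Bool => Ψ r.castSucc ∉ G).card := by
  have hset : (univ.filter fun Ψ : Fin (k + 1) → Fin m → Fin k → Fin n × Bool => splice k Ψ r q ∉ G) =
      (univ.filter fun Ψ : Fin (k + 1) → Fin m → Fin k → Fin n × Bool => Ψ r.castSucc ∉ G).image
        (swapLayers k r q) := by
    ext Ψ
    simp only [mem_filter, mem_univ, true_and, mem_image]
    constructor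
    · intro h
      refine ⟨swapLayers k r q Ψ, ?_, swapLayers_swapLayers r q Ψ⟩
      rwa [swapLayers_castSucc]
    · rintro ⟨Ψ', h', rfl⟩
      have := swapLayers_castSucc r q (swapLayers k r q Ψ')
      rw [swapLayers_swapLayers] at this
      rwa [← this]
  rw [hset, card_image_of_injective _ (swapLayers_injective r q)]

/-- Counting tuples by one coordinate. -/
theorem card_filter_coord_not_mem (G : Finset (Fin m → Fin k → Fin n × Bool)) (i₀ : Fin (k + 1)) :
    (univ.filter fun Ψ : Fin (k + 1) → Fin m → Fin k → Fin n × Bool => Ψ i₀ ∉ G).card =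
      (univ.filter fun Φ : Fin m → Fin k → Fin n × Bool => Φ ∉ G).card *
        Fintype.card (Fin m → Fin k → Fin n × Bool) ^ k := by
  classical
  let e := Fin.insertNthEquiv (fun _ : Fin (k + 1) => Fin m → Fin k → Fin n × Bool) i₀
  have hset : (univ.filter fun Ψ : Fin (k + 1) → Fin m → Fin k → Fin n × Bool => Ψ i₀ ∉ G) =
      ((univ.filter fun Φ : Fin m → Fin k → Fin n × Bool => Φ ∉ G) ×ˢ
        (univ : Finset (Fin k → Fin m → Fin k → Fin n × Bool))).image e := by
    ext Ψ
    simp only [mem_filter, mem_univ, true_and, mem_image, mem_product, and_true]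
    constructor
    · intro h
      refine ⟨e.symm Ψ, ?_, e.apply_symm_apply Ψ⟩
      simpa [e] using h
    · rintro ⟨p, hp, rfl⟩
      simpa [e] using hp
  rw [hset, card_image_of_injective _ e.injective, card_product, card_univ, Fintype.card_fun,
    Fintype.card_fin]

/-- Consecutive splice points differ in at most one slot. -/
theorem oneSlotApart_splice_succ (Ψ : Fin (k + 1) → Fin m → Fin k → Fin n × Bool) (r : Fin k) (q : ℕ) :
    OneSlotApart (splice k Ψ r q) (splice k Ψ r (q + 1)) := by
  unfold OneSlotApart
  refine card_le_one.mpr ?_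
  intro p hp p' hp'
  simp only [mem_filter, mem_univ, true_and, splice] at hp hp'
  have h1 : (p.1 : ℕ) * k + p.2 = q := by
    by_contra hne
    apply hp
    have : ((p.1 : ℕ) * k + p.2 < q) = ((p.1 : ℕ) * k + p.2 < q + 1) := by
      apply propext; omega
    simp [this]
  have h2 : (p'.1 : ℕ) * k + p'.2 = q := by
    by_contra hne
    apply hp'
    have : ((p'.1 : ℕ) * k + p'.2 < q) = ((p'.1 : ℕ) * k + p'.2 < q + 1) := by
      apply propext; omega
    simp [this]
  have hb : (p.2 : ℕ) < k := p.2.isLt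
  have hb' : (p'.2 : ℕ) < k := p'.2.isLt
  have hfst : (p.1 : ℕ) = p'.1 := by
    have := Nat.add_mul_div_left (p.2 : ℕ) (p.1 : ℕ) (show 0 < k by omega)
    have := Nat.add_mul_div_left (p'.2 : ℕ) (p'.1 : ℕ) (show 0 < k by omega)
    have e1 : ((p.1 : ℕ) * k + p.2) / k = p.1 := by
      rw [show (p.1 : ℕ) * k + p.2 = p.2 + p.1 * k by ring, Nat.add_mul_div_right _ _ (show 0 < k by omega),
        Nat.div_eq_of_lt hb, zero_add]
    have e2 : ((p'.1 : ℕ) * k + p'.2) / k = p'.1 := by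
      rw [show (p'.1 : ℕ) * k + p'.2 = p'.2 + p'.1 * k by ring, Nat.add_mul_div_right _ _ (show 0 < k by omega),
        Nat.div_eq_of_lt hb', zero_add]
    rw [← e1, ← e2, h1, h2]
  have hsnd : (p.2 : ℕ) = p'.2 := by rw [hfst] at h1; omega
  exact Prod.ext (Fin.ext hfst) (Fin.ext hsnd)

end Bridge

/-- **Bridge (first lemma of the line; pure counting).** If `g` is `ν`-valid on every
instance of a set `G` and `ηn`-Lipschitz across every one-slot move out of `G`, and the complement of
`G` has density at most `1/(2k(mk+1))`, then at least half of all paths `Ψ` realise the path event.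
Proof: for each splice point `(r,q)` the map `Ψ ↦ P r q` has the law of a coordinate
(`card_filter_splice_not_mem`, by the layer-swapping involution), so
`#{Ψ : ∃ r q, P r q ∉ G} ≤ k(mk+1) · #Gᶜ · #inst^k ≤ #paths / 2`; on the complement every splice point is
in `G`, giving validity, and consecutive splice points are one slot apart, giving stability. -/
theorem pathEvent_of_goodSet {k n m : ℕ} {η ν : ℝ}
    (g : (Fin m → Fin k → Fin n × Bool) → (Fin n → Bool))
    (G : Finset (Fin m → Fin k → Fin n × Bool))
    (hval : ∀ Φ ∈ G, (violated g Φ : ℝ) ≤ ν * m)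
    (hlip : ∀ Φ ∈ G, ∀ Φ' : Fin m → Fin k → Fin n × Bool, OneSlotApart Φ Φ' →
      (hammingDist (g Φ) (g Φ') : ℝ) ≤ η * n)
    (hG : 2 * (k * (m * k + 1)) * (univ.filter fun Φ : Fin m → Fin k → Fin n × Bool => Φ ∉ G).card ≤
      Fintype.card (Fin m → Fin k → Fin n × Bool)) :
    Fintype.card (Fin (k + 1) → Fin m → Fin k → Fin n × Bool) ≤
      2 * (univ.filter fun Ψ : Fin (k + 1) → Fin m → Fin k → Fin n × Bool => PathGood k n m η ν g Ψ).card := by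
  classical
  -- abbreviations
  set N : ℕ := Fintype.card (Fin m → Fin k → Fin n × Bool) with hN
  set b : ℕ := (univ.filter fun Φ : Fin m → Fin k → Fin n × Bool => Φ ∉ G).card with hb
  -- the bad set: some splice point leaves `G`
  let Bad : Finset (Fin (k + 1) → Fin m → Fin k → Fin n × Bool) :=
    univ.filter fun Ψ => ∃ r : Fin k, ∃ q : Fin (m * k + 1), splice k Ψ r q ∉ G
  -- (1) union bound: #Bad ≤ k (mk+1) · b · N^k
  have hBad : Bad.card ≤ k * (m * k + 1) * (b * N ^ k) := by
    have hsub : Bad ⊆ (univ : Finset (Fin k × Fin (m * k + 1))).biUnion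
        (fun rq => univ.filter fun Ψ : Fin (k + 1) → Fin m → Fin k → Fin n × Bool =>
          splice k Ψ rq.1 rq.2 ∉ G) := by
      intro Ψ hΨ
      simp only [Bad, mem_filter, mem_univ, true_and] at hΨ
      obtain ⟨r, q, hrq⟩ := hΨ
      simp only [mem_biUnion, mem_univ, true_and, mem_filter]
      exact ⟨(r, q), hrq⟩
    calc Bad.card ≤ _ := card_le_card hsub
      _ ≤ ∑ rq : Fin k × Fin (m * k + 1), (univ.filter fun Ψ : Fin (k + 1) → Fin m → Fin k → Fin n × Bool =>
            splice k Ψ rq.1 rq.2 ∉ G).card := card_biUnion_le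
      _ = ∑ _rq : Fin k × Fin (m * k + 1), b * N ^ k := by
            refine sum_congr rfl fun rq _ => ?_
            rw [card_filter_splice_not_mem, card_filter_coord_not_mem]
      _ = k * (m * k + 1) * (b * N ^ k) := by
            simp [sum_const, card_univ, Fintype.card_prod, Fintype.card_fin]
  -- (2) good paths realise the event
  have hgood : univ \ Bad ⊆ (univ.filter fun Ψ : Fin (k + 1) → Fin m → Fin k → Fin n × Bool =>
      PathGood k n m η ν g Ψ) := by
    intro Ψ hΨ
    simp only [mem_sdiff, mem_univ, true_and, Bad, mem_filter, not_exists, not_not] at hΨ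
    simp only [mem_filter, mem_univ, true_and]
    rw [pathGood_iff]
    have hmem : ∀ r : Fin k, ∀ q ≤ m * k, splice k Ψ r q ∈ G := by
      intro r q hq
      have := hΨ r ⟨q, Nat.lt_succ_of_le hq⟩
      simpa using this
    constructor
    · intro r q hq
      exact hval _ (hmem r q hq)
    · intro r q hq
      exact hlip _ (hmem r q hq.le) _ (oneSlotApart_splice_succ Ψ r q)
  -- (3) assemble the count
  have hpaths : Fintype.card (Fin (k + 1) → Fin m → Fin k → Fin n × Bool) = N ^ (k + 1) := by
    rw [Fintype.card_fun, Fintype.card_fin]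
  have hsplit : Fintype.card (Fin (k + 1) → Fin m → Fin k → Fin n × Bool) ≤
      Bad.card + (univ.filter fun Ψ : Fin (k + 1) → Fin m → Fin k → Fin n × Bool =>
        PathGood k n m η ν g Ψ).card := by
    calc Fintype.card (Fin (k + 1) → Fin m → Fin k → Fin n × Bool)
        = (univ : Finset (Fin (k + 1) → Fin m → Fin k → Fin n × Bool)).card := card_univ.symm
      _ = Bad.card + (univ \ Bad).card := by
            have := card_sdiff_add_card_eq_card (subset_univ Bad); omega
      _ ≤ Bad.card + _ := Nat.add_le_add_left (card_le_card hgood) _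
  have hhalf : 2 * Bad.card ≤ Fintype.card (Fin (k + 1) → Fin m → Fin k → Fin n × Bool) := by
    rw [hpaths, pow_succ]
    calc 2 * Bad.card ≤ 2 * (k * (m * k + 1) * (b * N ^ k)) := Nat.mul_le_mul_left 2 hBad
      _ = (2 * (k * (m * k + 1)) * b) * N ^ k := by ring
      _ ≤ N * N ^ k := Nat.mul_le_mul_right _ hG
      _ = N ^ k * N := by ring
  omega

/-- **Transfer target `C⁺(k, α, η, ν)` (single instance, no path):** for infinitely many `n`, at
`m = ⌊α n⌋`, some map `g` (no complexity bound) and some set `G` of instances of density at least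
`1 - 1/(2k(mk+1))` exist with `g` `ν`-valid on `G` and `ηn`-Lipschitz across one-slot moves out of `G`.
Intended witnesses: `r`-local factor-graph rules (Bresler–Huang Def. 2.12), for which validity w.h.p.
follows from validity with positive probability by bounded-difference concentration (BH §7.6) and the
Lipschitz bound is deterministic on bounded-degree instances (`≤ 3 Δ^{2r}` outputs see a changed slot). -/
def TypicallyStableValid (k : ℕ) (α η ν : ℝ) : Prop :=
  ∃ᶠ n : ℕ in Filter.atTop, ∀ m : ℕ, m = ⌊α * n⌋₊ →
    ∃ g : (Fin m → Fin k → Fin n × Bool) → (Fin n → Bool), ∃ G : Finset (Fin m → Fin k → Fin n × Bool),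
      (∀ Φ ∈ G, (violated g Φ : ℝ) ≤ ν * m) ∧
      (∀ Φ ∈ G, ∀ Φ' : Fin m → Fin k → Fin n × Bool, OneSlotApart Φ Φ' →
        (hammingDist (g Φ) (g Φ') : ℝ) ≤ η * n) ∧
      2 * (k * (m * k + 1)) * (univ.filter fun Φ : Fin m → Fin k → Fin n × Bool => Φ ∉ G).card ≤
        Fintype.card (Fin m → Fin k → Fin n × Bool)

/-- The crux's hypothesis, verbatim: some deterministic polynomial-time `f` solves `F_k(n, ⌊αn⌋)` with
probability `≥ ε` for infinitely many `n`. -/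
def PolySolvable (k : ℕ) (α : ℝ) : Prop :=
  ∃ f : List Bool → List Bool, Literature.Computability.Complexity.IsPolyTime f ∧ ∃ ε : ℝ, 0 < ε ∧
    ∃ᶠ n : ℕ in Filter.atTop, ∀ m : ℕ, m = ⌊α * n⌋₊ → ε ≤
      ((univ.filter fun Φ : Fin m → Fin k → Fin n × Bool => ∀ i, ∃ j,
        (f (Literature.Computability.Complexity.encodingCNF.encode
          (List.ofFn fun a => List.ofFn fun b => (((Φ a b).1 : ℕ), (Φ a b).2)))).getD (Φ i j).1 false
            = (Φ i j).2).card : ℝ) / Fintype.card (Fin m → Fin k → Fin n × Bool)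

/-- **The transferred crux `C⁺` ("local shadow"):** efficiently solvable with non-vanishing probability
⇒ typically-stable `ν`-valid maps exist, for every `η, ν > 0`.  Stronger than the crux (it implies it
by `transfer_suffices`), path-free, and — read through local rules — the statement "the poly-time
near-satisfaction value of random `k`-SAT equals its local-algorithm value". -/
def LocalShadowTransfer : Prop :=
  ∀ k : ℕ, 3 ≤ k → ∀ α η ν : ℝ, 0 < α → 0 < η → 0 < ν → PolySolvable k α → TypicallyStableValid k α η ν

/-- **Composition:** the transfer implies the crux, through `pathEvent_of_goodSet` and
`Real.exp (-(c n)) ≤ 1/2` for `n ≥ 1/c`. (The `∃ᶠ n` of `TypicallyStableValid` must be taken along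
`n` with `exp(-cn) ≤ 1/2`, which is cofinitely true, so `Frequently.and_eventually` applies.) -/
theorem transfer_suffices (h : LocalShadowTransfer) :
    Summit.PneNP.PneNP.Theses.OverlapGapAlgebra.SolvableImpliesStableSection := by
  intro k hk α η ν hα hη hν hyp c hc
  have hT : TypicallyStableValid k α η ν := h k hk α η ν hα hη hν hyp
  -- cofinitely, `exp (-(c n)) ≤ 1/2`
  have hev : ∀ᶠ n : ℕ in Filter.atTop, Real.exp (-(c * n)) ≤ 1 / 2 := by
    have h1 : Filter.Tendsto (fun n : ℕ => Real.exp (-(c * n))) Filter.atTop (nhds 0) := by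
      have : Filter.Tendsto (fun n : ℕ => c * (n : ℝ)) Filter.atTop Filter.atTop :=
        Filter.Tendsto.const_mul_atTop hc tendsto_natCast_atTop_atTop
      exact Real.tendsto_exp_neg_atTop_nhds_zero.comp this
    exact (h1.eventually (ge_mem_nhds (by norm_num : (0 : ℝ) < 1 / 2)))
  refine (hT.and_eventually hev).mono ?_
  rintro n ⟨hn, hexp⟩ m hm
  obtain ⟨g, G, hval, hlip, hG⟩ := hn m hm
  refine ⟨g, ?_⟩
  have hb := pathEvent_of_goodSet (η := η) (ν := ν) g G hval hlip hG
  have hb' : (Fintype.card (Fin (k + 1) → Fin m → Fin k → Fin n × Bool) : ℝ) ≤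
      2 * ((univ.filter fun Ψ : Fin (k + 1) → Fin m → Fin k → Fin n × Bool =>
        PathGood k n m η ν g Ψ).card : ℝ) := by
    exact_mod_cast hb
  have hpos : (0 : ℝ) ≤ (Fintype.card (Fin (k + 1) → Fin m → Fin k → Fin n × Bool) : ℝ) :=
    Nat.cast_nonneg _
  have key : Real.exp (-(c * n)) * (Fintype.card (Fin (k + 1) → Fin m → Fin k → Fin n × Bool) : ℝ) ≤
      ((univ.filter fun Ψ : Fin (k + 1) → Fin m → Fin k → Fin n × Bool => PathGood k n m η ν g Ψ).card : ℝ) := by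
    nlinarith [hexp, hb', hpos, Real.exp_pos (-(c * n))]
  -- the crux's inline path predicate is `PathGood` verbatim (up to the `Decidable` instance term)
  convert key using 4
  exact Iff.rfl

end Summit.PneNP.PneNP.Cruxes.SolvableImpliesStableSection.LocalShadow

end
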